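import Summits.CriticalPhenomena.SAWScalingLimit.Theorems.SAWDefectDecoherenceMassRatioFlatRootGlue
import Summits.CriticalPhenomena.SAWScalingLimit.Theorems.SAWDefectDecoherenceMassRatioSwapArcPositive

/-!
# Crux `SAWDefectDecoherence.MassRatio` (stmt-CriticalPhenomena-8550) — line `flat-root-arc-swap`,
# lead c1, RESHAPE 1 (skeleton over the LANDED vocabulary, glue and stub 3)

State after cycle 1 (2026-08-16, lead `prover-line-stmt-CriticalPhenomena-8550-c1-0`; the line is
co-driven by lead `…-a1-1`, who picked it first and landed stub 3):

* LANDED `Theorems/SAWDefectDecoherenceMassRatioFlatRootDefs.lean` (p96567, c1): `Frame`, `swapArc`,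
  `massK`, `halfDisc`, predicates `MassRatioAt c`, `RootSwap ε`, `RootSwapArc ε`, `ArcMassRatio c`,
  `SwapArcPositive D ρ Λ m a b`, `HalfDiscArcArrival B`, `ArcRootedBulkMass A`, finiteness, `domainMono`.
* LANDED `Theorems/SAWDefectDecoherenceMassRatioFlatRootGlue.lean` (p99446, c1):
  `massRatio_of_flatRootStubs : (∀ ε > 0, RootSwapArc ε) → (∃ c < 3/4, ArcMassRatio c) →
  (∀ datum, SwapArcPositive …) → MassRatio` (registered sub-goal) + `Glue.massRatioAt_of` (every cut),
  `Glue.arcMassRatio_of_split`, `Glue.rootSwapArc_of_rootSwap`, `Glue.massRatio_of_massRatioAt`.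
* LANDED `Theorems/SAWDefectDecoherenceMassRatioSwapArcPositive.lean` (p96866, lead a1-1):
  `ArcSwap.stub_swapArcPositive` — registered stub 3, CLOSED.
* OPEN (registered, `sorry` only there): `stub_rootSwapArc` (worker c1 wave 1: stub-blocked on the
  change-of-root primitive `RootSwap ε` = SAW boundary quasi-multiplicativity; reduction + wild/tame
  factorisation in item evidence `stub_rootSwapArc.lean`), `stub_arcMassRatio` (lead: the crux's
  sharp-exponent residual; its bulk half `ArcRootedBulkMass A` is open for EVERY `A`, see
  `LEAD-REPORT-c1.md`).

So the skeleton is now: two stubs + a three-line composition through the landed glue.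
`lean check`: rc 0, 2 sorries (the two stubs), `MassRatio_of` concludes the crux by name.
-/

namespace Summit.CriticalPhenomena.SAWScalingLimit.Cruxes.MassRatio.FlatRootArcSwap

open Literature.Probability.LatticeModels Literature.Probability.RandomPlanarGeometry
open Literature.Probability.RandomPlanarGeometry.SAW
open Summit.CriticalPhenomena.SAWScalingLimit.Theses.SAWDefectDecoherence
open Summit.CriticalPhenomena.SAWScalingLimit.Theorems.MassRatio
open Summit.CriticalPhenomena.SAWScalingLimit.Theorems.MassRatio.FlatRoot

noncomputable section
open scoped Classical

/-! ## Stubs (registered; `sorry` only here) -/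

/-- **Stub 1 — `RootSwapArc(ε)` for every `ε > 0`** (root swap summed over the swap arc; the
"change of root" lemma). OPEN: SAW boundary quasi-multiplicativity; see the worker's reduction file
(item evidence `stub_rootSwapArc.lean`: `RootSwap ⇒ stub`, `CrossRatioBound ⇒ RootSwap`,
`stub ⇒ WildRootRelease`, `WildRootRelease(ε₁) ∧ FlatArcHarnack(ε₂) ⇒ RootSwap(ε₁+ε₂)`). -/
theorem stub_rootSwapArc : ∀ ε : ℝ, 0 < ε →
    ∀ (D : DobrushinDomain) (ρ : ℝ) (Λ : ℝ → Finset HexVertex) (m : ℝ → ℤ)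
      (a b : ℝ → Sym2 HexVertex),
      0 < ρ →
      D.carrier ∩ Metric.ball (D.pt 1) ρ = {z : ℂ | (D.pt 1).im < z.im} ∩ Metric.ball (D.pt 1) ρ →
      (∀ᶠ δ : ℝ in nhdsWithin 0 (Set.Ioi 0),
        hexDomainSimplyConnected (Λ δ) ∧ a δ ∈ hexDomainBoundary (Λ δ) ∧
          b δ ∈ hexDomainBoundary (Λ δ) ∧ Nonempty (HexMidEdgeSAW (Λ δ) (a δ) (b δ)) ∧
          (hexGraph.induce ((Λ δ : Finset HexVertex) : Set HexVertex)).Preconnected ∧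
          (∀ v ∈ Λ δ, (δ : ℂ) * hexCenter v ∈ D.carrier) ∧
          (∀ v : HexVertex, (δ : ℂ) * hexCenter v ∈ Metric.ball (D.pt 1) ρ →
            (v ∈ Λ δ ↔ m δ ≤ v.1 1))) →
      (∀ K : Set ℂ, IsCompact K → K ⊆ D.carrier → ∀ᶠ δ : ℝ in nhdsWithin 0 (Set.Ioi 0),
        ∀ v : HexVertex, (δ : ℂ) * hexCenter v ∈ K → v ∈ Λ δ) →
      Filter.Tendsto (fun δ : ℝ => (δ : ℂ) * hexMidpoint (a δ)) (nhdsWithin 0 (Set.Ioi 0))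
        (nhds (D.pt 0)) →
      Filter.Tendsto (fun δ : ℝ => (δ : ℂ) * hexMidpoint (b δ)) (nhdsWithin 0 (Set.Ioi 0))
        (nhds (D.pt 1)) →
      ∀ K : Set ℂ, IsCompact K → K ⊆ D.carrier → ∃ C : ℝ,
        ∀ᶠ δ : ℝ in nhdsWithin 0 (Set.Ioi 0),
          (δ ^ 2 * ∑ᶠ e ∈ {e : Sym2 HexVertex | e ∈ hexDomainMidEdges (Λ δ) ∧
              (δ : ℂ) * hexMidpoint e ∈ K},
              ‖hexParafermionicObservable (Λ δ) (a δ) hexCriticalFugacity 0 e‖) *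
            (∑ᶠ a' ∈ {e : Sym2 HexVertex | e ∈ hexDomainBoundary (Λ δ) ∧
              ρ / 4 ≤ dist ((δ : ℂ) * hexMidpoint e) (D.pt 1) ∧
              dist ((δ : ℂ) * hexMidpoint e) (D.pt 1) ≤ ρ / 2},
              ‖hexParafermionicObservable (Λ δ) (b δ) hexCriticalFugacity 0 a'‖) ≤
          C * δ ^ (-ε) * ‖hexParafermionicObservable (Λ δ) (a δ) hexCriticalFugacity 0 (b δ)‖ *
            ∑ᶠ a' ∈ {e : Sym2 HexVertex | e ∈ hexDomainBoundary (Λ δ) ∧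
              ρ / 4 ≤ dist ((δ : ℂ) * hexMidpoint e) (D.pt 1) ∧
              dist ((δ : ℂ) * hexMidpoint e) (D.pt 1) ≤ ρ / 2},
              (δ ^ 2 * ∑ᶠ e ∈ {e : Sym2 HexVertex | e ∈ hexDomainMidEdges (Λ δ) ∧
                (δ : ℂ) * hexMidpoint e ∈ K},
                ‖hexParafermionicObservable (Λ δ) a' hexCriticalFugacity 0 e‖) := by
  sorry

/-- **Stub 2 — `ArcMassRatio(c)` for some `c < 3/4`** (HARDEST; the crux's sharp-exponent residual:
arc-rooted normalised bulk mass against the far-arc arrival mass from the tame root `b_δ` in `H_δ`).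
OPEN-PROBLEM grade: by `Glue.arcMassRatio_of_split` it is fed by `HalfDiscArcArrival B` and
`ArcRootedBulkMass A` with `A + B ≤ c`; the bulk half is open for EVERY exponent `A` (no polynomial
bound on critical SAW two-point masses is known; finiteness of `G_{x_c}` in `d = 2` is itself open,
Madras–Slade 1993 §1.4), and `MassRatio(3/4)` is false at the simple-random-walk exponents. -/
theorem stub_arcMassRatio : ∃ c : ℝ, c < 3 / 4 ∧
    ∀ (D : DobrushinDomain) (ρ : ℝ) (Λ : ℝ → Finset HexVertex) (m : ℝ → ℤ)
      (a b : ℝ → Sym2 HexVertex),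
      0 < ρ →
      D.carrier ∩ Metric.ball (D.pt 1) ρ = {z : ℂ | (D.pt 1).im < z.im} ∩ Metric.ball (D.pt 1) ρ →
      (∀ᶠ δ : ℝ in nhdsWithin 0 (Set.Ioi 0),
        hexDomainSimplyConnected (Λ δ) ∧ a δ ∈ hexDomainBoundary (Λ δ) ∧
          b δ ∈ hexDomainBoundary (Λ δ) ∧ Nonempty (HexMidEdgeSAW (Λ δ) (a δ) (b δ)) ∧
          (hexGraph.induce ((Λ δ : Finset HexVertex) : Set HexVertex)).Preconnected ∧
          (∀ v ∈ Λ δ, (δ : ℂ) * hexCenter v ∈ D.carrier) ∧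
          (∀ v : HexVertex, (δ : ℂ) * hexCenter v ∈ Metric.ball (D.pt 1) ρ →
            (v ∈ Λ δ ↔ m δ ≤ v.1 1))) →
      (∀ K : Set ℂ, IsCompact K → K ⊆ D.carrier → ∀ᶠ δ : ℝ in nhdsWithin 0 (Set.Ioi 0),
        ∀ v : HexVertex, (δ : ℂ) * hexCenter v ∈ K → v ∈ Λ δ) →
      Filter.Tendsto (fun δ : ℝ => (δ : ℂ) * hexMidpoint (a δ)) (nhdsWithin 0 (Set.Ioi 0))
        (nhds (D.pt 0)) →
      Filter.Tendsto (fun δ : ℝ => (δ : ℂ) * hexMidpoint (b δ)) (nhdsWithin 0 (Set.Ioi 0))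
        (nhds (D.pt 1)) →
      ∀ K : Set ℂ, IsCompact K → K ⊆ D.carrier → ∃ C : ℝ,
        ∀ᶠ δ : ℝ in nhdsWithin 0 (Set.Ioi 0),
          (∑ᶠ a' ∈ {e : Sym2 HexVertex | e ∈ hexDomainBoundary (Λ δ) ∧
              ρ / 4 ≤ dist ((δ : ℂ) * hexMidpoint e) (D.pt 1) ∧
              dist ((δ : ℂ) * hexMidpoint e) (D.pt 1) ≤ ρ / 2},
              (δ ^ 2 * ∑ᶠ e ∈ {e : Sym2 HexVertex | e ∈ hexDomainMidEdges (Λ δ) ∧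
                (δ : ℂ) * hexMidpoint e ∈ K},
                ‖hexParafermionicObservable (Λ δ) a' hexCriticalFugacity 0 e‖)) ≤
          C * δ ^ (-c) *
            ∑ᶠ a' ∈ {e : Sym2 HexVertex | e ∈ hexDomainBoundary (Λ δ) ∧
              ρ / 4 ≤ dist ((δ : ℂ) * hexMidpoint e) (D.pt 1) ∧
              dist ((δ : ℂ) * hexMidpoint e) (D.pt 1) ≤ ρ / 2},
              ‖hexParafermionicObservable
                  ((Λ δ).filter fun v => dist ((δ : ℂ) * hexCenter v) (D.pt 1) < 3 * ρ / 4)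
                  (b δ) hexCriticalFugacity 0 a'‖ := by
  sorry

/-! ## The stubs deliver the predicates of `…FlatRootDefs` (definitional unfolding only) -/

/-- Stub 1 in predicate form. -/
theorem rootSwapArc_of_stub : ∀ ε : ℝ, 0 < ε → RootSwapArc ε := by
  intro ε hε D ρ Λ m a b hF K hK hKD
  obtain ⟨hρ, hflat, hadm, hexh, ha, hb⟩ := hF
  exact stub_rootSwapArc ε hε D ρ Λ m a b hρ hflat hadm hexh ha hb K hK hKD

/-- Stub 2 in predicate form. -/
theorem arcMassRatio_of_stub : ∃ c : ℝ, c < 3 / 4 ∧ ArcMassRatio c := by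
  obtain ⟨c, hc, h⟩ := stub_arcMassRatio
  refine ⟨c, hc, ?_⟩
  intro D ρ Λ m a b hF K hK hKD
  obtain ⟨hρ, hflat, hadm, hexh, ha, hb⟩ := hF
  exact h D ρ Λ m a b hρ hflat hadm hexh ha hb K hK hKD

/-- Stub 3 (LANDED, `ArcSwap.stub_swapArcPositive`, p96866) in predicate form. -/
theorem swapArcPositive_of_landed :
    ∀ (D : DobrushinDomain) (ρ : ℝ) (Λ : ℝ → Finset HexVertex) (m : ℝ → ℤ)
      (a b : ℝ → Sym2 HexVertex), SwapArcPositive D ρ Λ m a b := by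
  intro D ρ Λ m a b hF
  obtain ⟨hρ, hflat, hadm, hexh, ha, hb⟩ := hF
  exact ArcSwap.stub_swapArcPositive D ρ Λ m a b hρ hflat hadm hexh ha hb

/-! ## Composition: the line concludes the crux by name through the landed glue -/

/-- **The line concludes the crux** from the two open stubs and the landed stub 3, via the landed
glue `FlatRoot.massRatio_of_flatRootStubs` (p99446). -/
theorem MassRatio_of : MassRatio :=
  massRatio_of_flatRootStubs rootSwapArc_of_stub arcMassRatio_of_stub swapArcPositive_of_landed

end

end Summit.CriticalPhenomena.SAWScalingLimit.Cruxes.MassRatio.FlatRootArcSwap
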